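import Literature.InformationTheory.QuantumCodes.CSSEquivalence
import Literature.InformationTheory.QuantumCodes.SyndromeDecodingCSS
import Literature.InformationTheory.QuantumCodes.HypergraphProductKernels
import HarnessLib

/-!
# Transport of explicit sector decoders along a re-indexing of a CSS code (FACT P for decoders)

Topic `InformationTheory/QuantumCodes`; namespace `Literature.InformationTheory.QuantumCodes`. LADDER-QEC (cell `qec`),
PARTITION row 08 (decoders as functions). A census row that IS a family code re-indexed (`C' = C.reindex e_X e_Z e_Q`,
`CSSEquivalence.lean`; e.g. `Census/ShorIdentification.lean`, `Census/TwistedTorusIdentification.lean`) should inherit the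
family's EXPLICIT decoder, not only its parameters. This file types the transport: the decoder of the re-indexed code reads
the syndrome through the check-row bijection, runs the original decoder, and renumbers the correction through the qubit
bijection — and corrects exactly the transported errors, with the same radius.

* `Decoder.reindexX D eZ eQ : Decoder (RZ' → 𝔽₂) (Q' → 𝔽₂) := σ' ↦ (D (σ' ∘ e_Z)) ∘ e_Q⁻¹` (and `reindexZ` with `e_X`);
* `CSSCode.xSyndrome_reindex` / `zSyndrome_reindex`: `H'^Z e' = (H^Z (e' ∘ e_Q)) ∘ e_Z⁻¹` (and the `X` twin);
* `Decoder.reindexX_corrects_iff` / `reindexZ_corrects_iff`: `D'` corrects `e'` on `C'` iff `D` corrects `e' ∘ e_Q` on `C`;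
* ★ `Decoder.reindexX_correctsUpTo_iff` / `reindexZ_correctsUpTo_iff`: `D'` corrects every pattern of weight `≤ t` on `C'`
  iff `D` does on `C` (Hamming weight is invariant under renumbering) — so the transported decoder has the same radius.

0 named facts, no `decide`, no instances/notation; axioms standard. HONEST FRAMING: bookkeeping (Lin–Pryadko 2024 Thm 6 says
equivalent codes have the same parameters; this is its decoder-level companion); no novelty.

References: [LinPryadko2024] H.-K. Lin, L. P. Pryadko, arXiv:2306.16400 §4.2 Thm 6 and App. (p0009 L66–74, p0018 L3–14:
permutation-equivalent codes; logical operators correspond). [NielsenChuang2010] §10.4.2 (p. 450: sector-wise CSS decoding).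
-/

namespace Literature.InformationTheory.QuantumCodes

open Matrix

variable {RX RZ Q RX' RZ' Q' : Type*} [Fintype Q] [Fintype Q']

namespace CSSCode

/-- **The `X`-syndrome of the re-indexed code**: `H'^Z e' = (H^Z (e' ∘ e_Q)) ∘ e_Z⁻¹`.
[cite: LinPryadko2024, App. proof of Thm 6(i) (arXiv:2306.16400 chunk p0018 L6–14)] -/
theorem xSyndrome_reindex [Fintype RZ] [Fintype RZ'] (C : CSSCode RX RZ Q) (eX : RX ≃ RX') (eZ : RZ ≃ RZ')
    (eQ : Q ≃ Q') (e' : Q' → ZMod 2) :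
    (C.reindex eX eZ eQ).xSyndrome e' = (C.xSyndrome (e' ∘ eQ)) ∘ eZ.symm := by
  rw [xSyndrome_apply, xSyndrome_apply]
  show Matrix.reindex eZ eQ C.HZ *ᵥ e' = _
  rw [reindex_apply, submatrix_mulVec_equiv, Equiv.symm_symm]

/-- **The `Z`-syndrome of the re-indexed code**: `H'^X e' = (H^X (e' ∘ e_Q)) ∘ e_X⁻¹`.
[cite: LinPryadko2024, App. proof of Thm 6(i) (arXiv:2306.16400 chunk p0018 L6–14)] -/
theorem zSyndrome_reindex [Fintype RX] [Fintype RX'] (C : CSSCode RX RZ Q) (eX : RX ≃ RX') (eZ : RZ ≃ RZ')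
    (eQ : Q ≃ Q') (e' : Q' → ZMod 2) :
    (C.reindex eX eZ eQ).zSyndrome e' = (C.zSyndrome (e' ∘ eQ)) ∘ eX.symm := by
  unfold zSyndrome
  show Matrix.reindex eX eQ C.HX *ᵥ e' = _
  rw [reindex_apply, submatrix_mulVec_equiv, Equiv.symm_symm]

end CSSCode

namespace Decoder

/-- **The transported `X`-sector decoder**: read the syndrome of the re-indexed code through `e_Z`, decode with `D`,
renumber the correction through `e_Q⁻¹`. Computable in `D`. (definition)
[cite: LinPryadko2024, §4.2 Thm 6 (arXiv:2306.16400 p0009 L66-74: permutation equivalence)] [cite: NielsenChuang2010, §10.4.2 (p. 450)] -/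
def reindexX (D : Decoder (RZ → ZMod 2) (Q → ZMod 2)) (eZ : RZ ≃ RZ') (eQ : Q ≃ Q') :
    Decoder (RZ' → ZMod 2) (Q' → ZMod 2) :=
  fun σ' => (D (σ' ∘ eZ)) ∘ eQ.symm

/-- **The transported `Z`-sector decoder** (syndrome read through `e_X`). Computable in `D`. (definition)
[cite: LinPryadko2024, §4.2 Thm 6 (arXiv:2306.16400 p0009 L66-74)] [cite: NielsenChuang2010, §10.4.2 (p. 450)] -/
def reindexZ (D : Decoder (RX → ZMod 2) (Q → ZMod 2)) (eX : RX ≃ RX') (eQ : Q ≃ Q') :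
    Decoder (RX' → ZMod 2) (Q' → ZMod 2) :=
  fun σ' => (D (σ' ∘ eX)) ∘ eQ.symm

/-- **The transported `X`-decoder corrects `e'` on the re-indexed code iff `D` corrects `e' ∘ e_Q` on the original.**
[cite: LinPryadko2024, §4.2 Thm 6 and App. (arXiv:2306.16400 p0009 L66–74, p0018 L3–14)] -/
theorem reindexX_corrects_iff [Fintype RX] [Fintype RZ] [Fintype RX'] [Fintype RZ'] (C : CSSCode RX RZ Q)
    (D : Decoder (RZ → ZMod 2) (Q → ZMod 2)) (eX : RX ≃ RX') (eZ : RZ ≃ RZ') (eQ : Q ≃ Q') (e' : Q' → ZMod 2) :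
    (D.reindexX eZ eQ).Corrects (C.reindex eX eZ eQ).xSyndrome
        ((C.reindex eX eZ eQ).rowSpX : Set (Q' → ZMod 2)) e' ↔
      D.Corrects C.xSyndrome (C.rowSpX : Set (Q → ZMod 2)) (e' ∘ eQ) := by
  unfold Decoder.Corrects
  rw [SetLike.mem_coe, SetLike.mem_coe, CSSCode.mem_rowSpX_reindex_iff, CSSCode.xSyndrome_reindex]
  have h : (D.reindexX eZ eQ (C.xSyndrome (e' ∘ eQ) ∘ eZ.symm) + e') ∘ eQ = D (C.xSyndrome (e' ∘ eQ)) + e' ∘ eQ := by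
    funext q
    simp [reindexX, Function.comp_def]
  rw [h]

/-- **The transported `Z`-decoder corrects `e'` on the re-indexed code iff `D` corrects `e' ∘ e_Q` on the original.**
[cite: LinPryadko2024, §4.2 Thm 6 and App. (arXiv:2306.16400 p0009 L66–74, p0018 L3–14)] -/
theorem reindexZ_corrects_iff [Fintype RX] [Fintype RZ] [Fintype RX'] [Fintype RZ'] (C : CSSCode RX RZ Q)
    (D : Decoder (RX → ZMod 2) (Q → ZMod 2)) (eX : RX ≃ RX') (eZ : RZ ≃ RZ') (eQ : Q ≃ Q') (e' : Q' → ZMod 2) :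
    (D.reindexZ eX eQ).Corrects (C.reindex eX eZ eQ).zSyndrome
        ((C.reindex eX eZ eQ).rowSpZ : Set (Q' → ZMod 2)) e' ↔
      D.Corrects C.zSyndrome (C.rowSpZ : Set (Q → ZMod 2)) (e' ∘ eQ) := by
  unfold Decoder.Corrects
  rw [SetLike.mem_coe, SetLike.mem_coe, CSSCode.mem_rowSpZ_reindex_iff, CSSCode.zSyndrome_reindex]
  have h : (D.reindexZ eX eQ (C.zSyndrome (e' ∘ eQ) ∘ eX.symm) + e') ∘ eQ = D (C.zSyndrome (e' ∘ eQ)) + e' ∘ eQ := by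
    funext q
    simp [reindexZ, Function.comp_def]
  rw [h]

/-- ★ **Same radius: the transported `X`-decoder corrects every pattern of weight `≤ t` on the re-indexed code iff `D` does
on the original** (the Hamming weight is invariant under renumbering). [cite: LinPryadko2024, §4.2 Thm 6 (arXiv:2306.16400 p0009 L66-74)] -/
theorem reindexX_correctsUpTo_iff [Fintype RX] [Fintype RZ] [Fintype RX'] [Fintype RZ'] (C : CSSCode RX RZ Q)
    (D : Decoder (RZ → ZMod 2) (Q → ZMod 2)) (eX : RX ≃ RX') (eZ : RZ ≃ RZ') (eQ : Q ≃ Q') (t : ℕ) :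
    (D.reindexX eZ eQ).CorrectsUpTo (C.reindex eX eZ eQ).xSyndrome
        ((C.reindex eX eZ eQ).rowSpX : Set (Q' → ZMod 2)) hammingNorm t ↔
      D.CorrectsUpTo C.xSyndrome (C.rowSpX : Set (Q → ZMod 2)) hammingNorm t := by
  constructor
  · intro h e he
    have h1 := h (e ∘ eQ.symm) (by rwa [hammingNorm_comp_equiv])
    rw [reindexX_corrects_iff] at h1
    have : (e ∘ eQ.symm) ∘ eQ = e := by funext q; simp
    rwa [this] at h1
  · intro h e' he'
    rw [reindexX_corrects_iff]
    refine h _ ?_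
    have : hammingNorm (e' ∘ eQ) = hammingNorm e' := by
      have := hammingNorm_comp_equiv e' eQ.symm
      rwa [Equiv.symm_symm] at this
    rwa [this]

/-- ★ **Same radius, `Z` sector.** [cite: LinPryadko2024, §4.2 Thm 6 (arXiv:2306.16400 p0009 L66-74)] -/
theorem reindexZ_correctsUpTo_iff [Fintype RX] [Fintype RZ] [Fintype RX'] [Fintype RZ'] (C : CSSCode RX RZ Q)
    (D : Decoder (RX → ZMod 2) (Q → ZMod 2)) (eX : RX ≃ RX') (eZ : RZ ≃ RZ') (eQ : Q ≃ Q') (t : ℕ) :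
    (D.reindexZ eX eQ).CorrectsUpTo (C.reindex eX eZ eQ).zSyndrome
        ((C.reindex eX eZ eQ).rowSpZ : Set (Q' → ZMod 2)) hammingNorm t ↔
      D.CorrectsUpTo C.zSyndrome (C.rowSpZ : Set (Q → ZMod 2)) hammingNorm t := by
  constructor
  · intro h e he
    have h1 := h (e ∘ eQ.symm) (by rwa [hammingNorm_comp_equiv])
    rw [reindexZ_corrects_iff] at h1
    have : (e ∘ eQ.symm) ∘ eQ = e := by funext q; simp
    rwa [this] at h1
  · intro h e' he'
    rw [reindexZ_corrects_iff]
    refine h _ ?_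
    have : hammingNorm (e' ∘ eQ) = hammingNorm e' := by
      have := hammingNorm_comp_equiv e' eQ.symm
      rwa [Equiv.symm_symm] at this
    rwa [this]

end Decoder

end Literature.InformationTheory.QuantumCodes
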